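import Mathlib.Analysis.SpecialFunctions.Log.Basic
import Literature.Computability.QuantumComplexity.GraphStateCutRank
import HarnessLib

/-!
# Twirled read-out error mitigation (TREX): Pauli-X twirling diagonalises any read-out noise map on the Pauli-Z observables

HONEST FRAMING (cell `pub-qadeq`, lane harvest-2): instance-level adjudication of specific
advantage claims; no claim about BQP vs BPP or the summit. This file is cited VOCABULARY: the
published argument behind the phrase "read-out error mitigation (TREX)" that the utility-type
experimental rows of the lane's register quote (E-17, E-36 below). Nothing here is asserted about
any device, any noise strength, or any classical cost.

## Source and the printed argument

E. van den Berg, Z. K. Minev, K. Temme, *Model-free readout-error mitigation for quantum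
expectation values*, Phys. Rev. A **105**, 032620 (2022) = arXiv:2012.09738
[vandenBergMinevTemme2022]; held text `paper:arxiv-2012.09738`, the `pNNNN Lnn` locators below
refer to that materialisation.

§3 "Derivation" (p0005). Outcomes are bit strings `x ∈ 𝔽₂ⁿ`; "measurement `y` can be
misinterpreted as `x` with probability `A_{x,y} = ⟨x|A|y⟩`" (L5–9), `X_s = Σ_a |a+s⟩⟨a|`,
`Z_s = Σ_a (−1)^{⟨s,a⟩}|a⟩⟨a|` (L12–14), `⟨Z_w⟩_ρ = Σ_x (−1)^{⟨w,x⟩} Tr(E_x ρ)` (eq. (IdealZs),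
L17–21). Random bit flips before the measurement, undone afterwards, replace `A` by "the twirled
noise map `A⋆ := 2^{−n} Σ_s X_s A X_s† = 2^{−n} Σ_s Σ_{a,b} A_{a,b} |a+s⟩⟨b+s|`" (L32–39). With
`|v_w⟩ = Σ_x (−1)^{⟨w,x⟩}|x⟩` the computation L64–76 gives "`A⋆|v_w⟩ = λ_w|v_w⟩`, with
`λ_w = 2^{−n} Σ_{a,b} (−1)^{⟨w,a+b⟩} A_{a,b}`. In other words, `|v_w⟩` is an (unnormalized)
eigenvector of `A⋆`", hence (L84–94) "`⟨Z̃⋆_w⟩_ρ = λ_w ⟨Z_w⟩_ρ`", and (L97–101) "For the initial state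
`ρ = |0⟩⟨0|` we have `⟨Z_w⟩_ρ = 1` and therefore `⟨Z̃⋆_w⟩_ρ = λ_w`. The protocol estimates this
quantity, and then uses it to obtain noise-mitigated estimates `⟨Z_w⟩_ρ` for other values of `ρ`"
(Protocol 1, p0004 L70–76: "Return estimate `f(𝒟₁,s)/f(𝒟₀,s)`"). §3.1 (p0005 L116–151): with the
Walsh–Hadamard matrix `H_n`, `M = H_n A H_n^{−1}` is the "readout transition matrix for operators";
averaging the sign masks over the Pauli-X group leaves "`[M ⊙ I, 0]`", i.e. the twirl
"diagonalizes the measurement channel" (p0003 L77–80), `λ = diag(M)`.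
§4.3 (p0007 L74–110): for independent flips with probability `r_ℓ` on qubit `ℓ`,
"`H A H^{−1} = ⊗_ℓ [1 0; 0 (1−2r_ℓ)]`" (eq. (BitFlipM)); "The diagonal term for `P_i` with `k`
non-identity term is then given by `(1−2r)^k`. The term `(1−2r)^k` is bounded below by `1−2kr`,
that means that for 30 qubits with 1% probability of a measurement flip, the diagonal elements in
`M` are still at least 0.4"; convex combinations `A = μA₁ + (1−μ)A₂` give `M = μM₁ + (1−μ)M₂`
(L69–72). §4.1 (p0006): Lemma 4.1 (ratio of two `α`-accurate estimates) and the arithmetic of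
Theorem 4.2 (`N ≥ 32 log(4/δ)/(M_{i,i}² ε²)` from Hoeffding's `2 exp(−Nα²/2)` with `α = εM_{i,i}/4`).

## Contents (all proved; 0 named facts, 0 `sorry`)

Bit strings are `B → ZMod 2` for a finite index type `B` of qubits (`n = |B|`); the character
`(−1)^{⟨w,x⟩}` is the tree's `GraphStateCutRank.chi (x ⬝ᵥ w)` (reused, not re-declared).

* `IsReadoutNoise A` — entries `≥ 0`, every column sums to `1` (a classical noise map on outcomes).
* `twirl A` — `A⋆_{x,y} = 2^{−n} Σ_s A_{x+s,y+s}`; `twirl_add_add` (`A⋆` commutes with every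
  `X_s`), `twirl_eq_self_of_forall_add_add` / `twirl_twirl`, `isReadoutNoise_twirl`,
  `twirl_add`, `twirl_smul` (convex combinations, §4.3).
* `eigval A w` — `λ_w`; **`sum_chi_mul_twirl`**: `Σ_x (−1)^{⟨w,x⟩} A⋆_{x,y} = λ_w (−1)^{⟨w,y⟩}`
  (the printed eigenvector statement, row form); `eigval_twirl`; `eigval_zero` (`λ_0 = 1`) and
  `abs_eigval_le_one` for a read-out noise map; `eigval_add` / `eigval_smul`.
* `zExp p w = Σ_x (−1)^{⟨w,x⟩} p(x)` (eq. (IdealZs) for an outcome law `p`) and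
  `readout A p = A p` (the law seen through the noise, `= A *ᵥ p`);
  **`zExp_readout_twirl`**: `⟨Z̃⋆_w⟩ = λ_w ⟨Z_w⟩`; `zExp_single_zero` (`⟨Z_w⟩ = 1` on `|0…0⟩`);
  **`zExp_readout_twirl_single_zero`** (the calibration run measures `λ_w`);
  **`mitigated_eq`**: `⟨Z̃⋆_w⟩_ρ / ⟨Z̃⋆_w⟩_{|0⟩⟨0|} = ⟨Z_w⟩_ρ` whenever `λ_w ≠ 0` — Protocol 1 in the
  infinite-sample limit (the estimator is a ratio of two empirical means of exactly these two
  quantities).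
* `transfer A` — `M = H A H^{−1}`; `transfer_apply_self` (`M_{w,w} = λ_w`),
  **`transfer_twirl`** / `transfer_twirl_eq_diagonal` (`H A⋆ H^{−1} = diag(λ)`: the twirl
  "diagonalizes the measurement channel").
* `indepFlip r` — independent symmetric bit flips; `isReadoutNoise_indepFlip`, `twirl_indepFlip`
  (already X-invariant), **`eigval_indepFlip`**: `λ_w = ∏_{i : w_i ≠ 0} (1 − 2r_i)`,
  `eigval_indepFlip_const` (`= (1−2r)^k`, `k` = weight of `w`), `one_sub_mul_le_one_sub_two_mul_pow`
  (`1 − 2kr ≤ (1−2r)^k` for `r ≤ 1`) and the printed instance `thirty_qubits_one_percent`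
  (`0.4 ≤ 0.98^30`).
* `abs_div_sub_div_le` — Lemma 4.1 (`|x̂/ŷ − x/y| ≤ 4α/|y|`); `two_mul_exp_le_iff` (Hoeffding's tail
  `2e^{−Nα²/2} ≤ δ/2 ⇔ N ≥ 2 log(4/δ)/α²`) and `sampleBound_eq` (with `α = εM/4` this is the
  printed `32 log(4/δ)/(M²ε²)`), the deterministic content of Theorem 4.2.

## What is NOT here (stated, not formalised)

The finite-sample protocol as random variables (the Hoeffding step of Theorem 4.2 itself — the tree
has Hoeffding-type bounds elsewhere — and Theorem 4.3's count of twirl instances `k`), imperfect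
state preparation (§4.4), preconditioning by an approximate inverse, the asymmetric single-qubit
matrix `r ≠ s` of eq. (AiMatrix) beyond the general `twirl`/`eigval` statements (which need no
product structure), correlated-noise examples, the simulations of §5, and anything about a
particular device's read-out fidelities.

## Why the lane holds it (E-links; quotations from the lane's own materialisations)

* E-17 (Kim et al., Nature 618, 500 (2023) [KimEtAl2023]), Supplementary Information p0003 L43–44:
  "to enable readout-error mitigation, we apply Pauli-X twirling of the measurements at the end of
  the circuit [S8]"; p0015 L97–98: "With appropriate twirling of the readout [S8], these error
  appear as multiplication of v by a readout fidelity. When known, this factor can be eliminated by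
  scalar division" ([S8] = the source above); main text p0005 L37–39: "614,400 samples (2,400
  circuit instances for each gain factor and readout error mitigation, with 64 shots per instance)".
* E-36 (Fischer et al., Nat. Phys. 22, 302 (2026) = arXiv:2411.00765 [FischerEtAl2026]), SI §2.3
  (held text p0015 L1–4): "we use a version of simple twirled readout error extinction (TREX)
  technique … we characterise the state preparation and measurement (SPAM) error for all qubits by
  measuring the single-qubit `⟨0|Ẑ_i|0⟩` expectation values while twirling the readout … Then, we
  divide the expectation values `⟨X̂_i⟩^TEM` by the measured `⟨0|Ẑ_i|0⟩` value" — exactly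
  `zExp_readout_twirl_single_zero` + `mitigated_eq` below, one qubit at a time.

## References

* [vandenBergMinevTemme2022] E. van den Berg, Z. K. Minev, K. Temme, Phys. Rev. A 105, 032620 (2022).
* [KimEtAl2023] Y. Kim et al., Nature 618, 500–505 (2023), Supplementary Information §I, §II.B.
* [FischerEtAl2026] L. E. Fischer et al., Nature Physics 22, 302–307 (2026), SI §2.3.
* [HeinEisertBriegel2004] (via `GraphStateCutRank`): the `𝔽₂` sign character and its orthogonality.
-/

noncomputable section

open Finset Matrix

namespace Literature.InformationTheory.QuantumLearning

namespace TREX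

open Literature.Computability.QuantumComplexity.GraphStateCutRank

variable {B : Type*} [Fintype B] [DecidableEq B]

/-! ### Bit strings `𝔽₂^B`: helper identities -/

omit [Fintype B] [DecidableEq B] in
/-- `s + s = 0` in `𝔽₂^B`. [folklore] -/
private theorem add_self_eq_zero' (s : B → ZMod 2) : s + s = 0 := by
  funext i
  have h : ∀ u : ZMod 2, u + u = 0 := by decide
  exact h (s i)

omit [Fintype B] [DecidableEq B] in
/-- `x + s + s = x` in `𝔽₂^B`. [folklore] -/
private theorem add_add_cancel' (x s : B → ZMod 2) : x + s + s = x := by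
  rw [add_assoc, add_self_eq_zero', add_zero]

omit [Fintype B] [DecidableEq B] in
/-- `y + (b + y) = b` in `𝔽₂^B`. [folklore] -/
private theorem add_add_cancel_left' (y b : B → ZMod 2) : y + (b + y) = b := by
  rw [add_comm b y, ← add_assoc, add_self_eq_zero', zero_add]

/-- `|𝔽₂^B| = 2^{|B|}` (as a real number). [folklore] -/
private theorem card_bits : (Fintype.card (B → ZMod 2) : ℝ) = 2 ^ Fintype.card B := by
  rw [Fintype.card_fun, ZMod.card]
  push_cast
  rfl

/-- `|𝔽₂^B| > 0` (as a real number). [folklore] -/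
private theorem card_bits_pos : 0 < (Fintype.card (B → ZMod 2) : ℝ) := by
  rw [card_bits]
  positivity

/-- `|χ(a)| = 1`. [folklore] -/
private theorem abs_chi (a : ZMod 2) : |(chi a : ℝ)| = 1 := by
  rw [chi, abs_pow, abs_neg, abs_one, one_pow]

/-- `χ` of a finite sum is the product of the `χ`'s. [folklore] -/
private theorem chi_finset_sum {ι : Type*} (s : Finset ι) (f : ι → ZMod 2) :
    (chi (∑ i ∈ s, f i) : ℝ) = ∏ i ∈ s, chi (f i) := by
  induction s using Finset.cons_induction with
  | empty => simp
  | cons a s ha ih => rw [sum_cons, prod_cons, chi_add, ih]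

/-- Sums over `ZMod 2` have two terms. [folklore] -/
private theorem sum_zmod_two (f : ZMod 2 → ℝ) : ∑ u, f u = f 0 + f 1 := by
  change ∑ u : Fin 2, f u = _
  rw [Fin.sum_univ_two]
  rfl

/-! ### Read-out noise maps and the Pauli-X twirl -/

/-- A (classical) read-out noise map on `n = |B|` bits: "measurement `y` can be misinterpreted as
`x` with probability `A_{x,y} = ⟨x|A|y⟩`", so the entries are non-negative and every column is a
probability vector. [cite: vandenBergMinevTemme2022, §3 p0005 L5–9] -/
structure IsReadoutNoise (A : Matrix (B → ZMod 2) (B → ZMod 2) ℝ) : Prop where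
  nonneg : ∀ x y, 0 ≤ A x y
  sum_eq_one : ∀ y, ∑ x, A x y = 1

/-- The **twirled noise map** `A⋆ := 2^{−n} Σ_s X_s A X_s† = 2^{−n} Σ_s Σ_{a,b} A_{a,b}|a+s⟩⟨b+s|`,
entrywise `A⋆_{x,y} = 2^{−n} Σ_s A_{x+s,y+s}` (random bit flips `X_s` before the noisy measurement,
undone on the recorded string). [cite: vandenBergMinevTemme2022, §3 p0005 L23–39] -/
def twirl (A : Matrix (B → ZMod 2) (B → ZMod 2) ℝ) : Matrix (B → ZMod 2) (B → ZMod 2) ℝ :=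
  of fun x y => (Fintype.card (B → ZMod 2) : ℝ)⁻¹ * ∑ s, A (x + s) (y + s)

/-- Entry formula of the twirl. [cite: vandenBergMinevTemme2022, §3 p0005 L34–39] -/
theorem twirl_apply (A : Matrix (B → ZMod 2) (B → ZMod 2) ℝ) (x y : B → ZMod 2) :
    twirl A x y = (Fintype.card (B → ZMod 2) : ℝ)⁻¹ * ∑ s, A (x + s) (y + s) := rfl

/-- `A⋆` commutes with every bit flip: `A⋆_{x+s,y+s} = A⋆_{x,y}`.
[cite: vandenBergMinevTemme2022, §3 p0005 L34–39] -/
theorem twirl_add_add (A : Matrix (B → ZMod 2) (B → ZMod 2) ℝ) (x y s : B → ZMod 2) :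
    twirl A (x + s) (y + s) = twirl A x y := by
  simp only [twirl_apply, add_assoc]
  congr 1
  exact Fintype.sum_equiv (Equiv.addLeft s) _ _ fun t => rfl

/-- A noise map that already commutes with all bit flips is its own twirl.
[cite: vandenBergMinevTemme2022, §4.3 p0007 L97–100 ("since `M` is already diagonal … it suffices
to choose an arbitrary but fixed value for `q`")] -/
theorem twirl_eq_self_of_forall_add_add (A : Matrix (B → ZMod 2) (B → ZMod 2) ℝ)
    (h : ∀ x y s, A (x + s) (y + s) = A x y) : twirl A = A := by
  ext x y
  simp only [twirl_apply, h, sum_const, card_univ, nsmul_eq_mul]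
  rw [← mul_assoc, inv_mul_cancel₀ card_bits_pos.ne', one_mul]

/-- Twirling is idempotent. [cite: vandenBergMinevTemme2022, §3 p0005 L34–39] -/
theorem twirl_twirl (A : Matrix (B → ZMod 2) (B → ZMod 2) ℝ) : twirl (twirl A) = twirl A :=
  twirl_eq_self_of_forall_add_add _ (twirl_add_add A)

/-- The twirl of a read-out noise map is a read-out noise map.
[cite: vandenBergMinevTemme2022, §3 p0005 L41–43 ("with associated measure `Ẽ⋆_x`")] -/
theorem isReadoutNoise_twirl {A : Matrix (B → ZMod 2) (B → ZMod 2) ℝ} (hA : IsReadoutNoise A) :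
    IsReadoutNoise (twirl A) := by
  refine ⟨fun x y => ?_, fun y => ?_⟩
  · rw [twirl_apply]
    exact mul_nonneg (inv_nonneg.mpr card_bits_pos.le) (sum_nonneg fun s _ => hA.nonneg _ _)
  · simp_rw [twirl_apply]
    rw [← mul_sum, sum_comm]
    have h1 : ∀ s : B → ZMod 2, ∑ x, A (x + s) (y + s) = 1 := fun s => by
      rw [Fintype.sum_equiv (Equiv.addRight s) (fun x => A (x + s) (y + s))
        (fun x => A x (y + s)) fun x => rfl]
      exact hA.sum_eq_one _
    simp_rw [h1]
    rw [sum_const, card_univ, nsmul_eq_mul, mul_one, inv_mul_cancel₀ card_bits_pos.ne']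

/-- Twirling is additive (convex combinations of noise maps, §4.3).
[cite: vandenBergMinevTemme2022, §4.3 p0007 L69–72] -/
theorem twirl_add (A A' : Matrix (B → ZMod 2) (B → ZMod 2) ℝ) :
    twirl (A + A') = twirl A + twirl A' := by
  ext x y
  simp only [twirl_apply, Matrix.add_apply, sum_add_distrib, mul_add]

/-- Twirling is homogeneous. [cite: vandenBergMinevTemme2022, §4.3 p0007 L69–72] -/
theorem twirl_smul (μ : ℝ) (A : Matrix (B → ZMod 2) (B → ZMod 2) ℝ) :
    twirl (μ • A) = μ • twirl A := by
  ext x y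
  simp only [twirl_apply, Matrix.smul_apply, smul_eq_mul]
  rw [← mul_sum]
  ring

/-! ### The eigenvalues `λ_w` and the eigenvector identity -/

/-- `λ_w = 2^{−n} Σ_{a,b} (−1)^{⟨w,a+b⟩} A_{a,b}`.
[cite: vandenBergMinevTemme2022, §3 p0005 L74–75] -/
def eigval (A : Matrix (B → ZMod 2) (B → ZMod 2) ℝ) (w : B → ZMod 2) : ℝ :=
  (Fintype.card (B → ZMod 2) : ℝ)⁻¹ * ∑ a, ∑ b, (chi ((a + b) ⬝ᵥ w) : ℝ) * A a b

/-- Unfolding `eigval`. [cite: vandenBergMinevTemme2022, §3 p0005 L74–75] -/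
theorem eigval_eq (A : Matrix (B → ZMod 2) (B → ZMod 2) ℝ) (w : B → ZMod 2) :
    eigval A w = (Fintype.card (B → ZMod 2) : ℝ)⁻¹ * ∑ a, ∑ b, (chi ((a + b) ⬝ᵥ w) : ℝ) * A a b :=
  rfl

/-- **The eigenvector identity** (row form of "`A⋆|v_w⟩ = λ_w|v_w⟩` … `⟨v_w|A⋆ = λ_w⟨v_w|`"):
`Σ_x (−1)^{⟨w,x⟩} A⋆_{x,y} = λ_w (−1)^{⟨w,y⟩}` for every read-out noise map `A`, every `w` and `y`.
[cite: vandenBergMinevTemme2022, §3 p0005 L56–81] -/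
theorem sum_chi_mul_twirl (A : Matrix (B → ZMod 2) (B → ZMod 2) ℝ) (w y : B → ZMod 2) :
    ∑ x, (chi (x ⬝ᵥ w) : ℝ) * twirl A x y = eigval A w * chi (y ⬝ᵥ w) := by
  have step1 : ∀ s : B → ZMod 2,
      ∑ x, (chi (x ⬝ᵥ w) : ℝ) * A (x + s) (y + s) = ∑ a, (chi ((a + s) ⬝ᵥ w) : ℝ) * A a (y + s) :=
    fun s => Fintype.sum_equiv (Equiv.addRight s) _ _ fun x => by
      simp only [Equiv.coe_addRight, add_add_cancel']
  calc ∑ x, (chi (x ⬝ᵥ w) : ℝ) * twirl A x y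
      = ∑ x, ∑ s, (Fintype.card (B → ZMod 2) : ℝ)⁻¹ * ((chi (x ⬝ᵥ w) : ℝ) * A (x + s) (y + s)) := by
        refine sum_congr rfl fun x _ => ?_
        rw [twirl_apply, mul_left_comm, mul_sum, mul_sum]
    _ = (Fintype.card (B → ZMod 2) : ℝ)⁻¹ *
          ∑ s, ∑ x, (chi (x ⬝ᵥ w) : ℝ) * A (x + s) (y + s) := by
        rw [sum_comm, mul_sum]
        refine sum_congr rfl fun s _ => ?_
        rw [mul_sum]
    _ = (Fintype.card (B → ZMod 2) : ℝ)⁻¹ *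
          ∑ s, ∑ a, (chi ((a + s) ⬝ᵥ w) : ℝ) * A a (y + s) := by simp_rw [step1]
    _ = (Fintype.card (B → ZMod 2) : ℝ)⁻¹ *
          ∑ b, ∑ a, (chi ((a + (b + y)) ⬝ᵥ w) : ℝ) * A a (y + (b + y)) := by
        congr 1
        exact (Fintype.sum_equiv (Equiv.addRight y) _ _ fun b => rfl).symm
    _ = (Fintype.card (B → ZMod 2) : ℝ)⁻¹ *
          ∑ b, ∑ a, (chi ((a + b) ⬝ᵥ w) : ℝ) * A a b * chi (y ⬝ᵥ w) := by
        congr 1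
        refine sum_congr rfl fun b _ => sum_congr rfl fun a _ => ?_
        rw [add_add_cancel_left', ← add_assoc, add_dotProduct, chi_add]
        ring
    _ = eigval A w * chi (y ⬝ᵥ w) := by
        rw [eigval_eq, sum_comm]
        simp_rw [← sum_mul]
        ring

/-- `λ_w` is read off the `0`-column of `A⋆`: `λ_w = Σ_x (−1)^{⟨w,x⟩} A⋆_{x,0}` (the calibration
identity in matrix form). [cite: vandenBergMinevTemme2022, §3 p0005 L97–101] -/
theorem eigval_eq_sum_chi_mul_twirl (A : Matrix (B → ZMod 2) (B → ZMod 2) ℝ) (w : B → ZMod 2) :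
    eigval A w = ∑ x, (chi (x ⬝ᵥ w) : ℝ) * twirl A x 0 := by
  rw [sum_chi_mul_twirl, zero_dotProduct, chi_zero, mul_one]

/-- The twirl does not change the eigenvalues. [cite: vandenBergMinevTemme2022, §3 p0005 L74–81] -/
theorem eigval_twirl (A : Matrix (B → ZMod 2) (B → ZMod 2) ℝ) (w : B → ZMod 2) :
    eigval (twirl A) w = eigval A w := by
  rw [eigval_eq_sum_chi_mul_twirl, twirl_twirl, ← eigval_eq_sum_chi_mul_twirl]

/-- `λ_0 = 1` for a read-out noise map (the trivial observable is unaffected).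
[cite: vandenBergMinevTemme2022, §4.3 eq. (BitFlipM) p0007 L89–95 (top-left entry `1`)] -/
theorem eigval_zero {A : Matrix (B → ZMod 2) (B → ZMod 2) ℝ} (hA : IsReadoutNoise A) :
    eigval A 0 = 1 := by
  simp only [eigval_eq, dotProduct_zero, chi_zero, one_mul]
  rw [sum_comm]
  simp_rw [hA.sum_eq_one]
  rw [sum_const, card_univ, nsmul_eq_mul, mul_one, inv_mul_cancel₀ card_bits_pos.ne']

/-- `|λ_w| ≤ 1` for a read-out noise map. [cite: vandenBergMinevTemme2022, §4.1 p0006 L90–93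
("`M_{i,i}` is expected to scale weakly exponential in the weight of the observable")] -/
theorem abs_eigval_le_one {A : Matrix (B → ZMod 2) (B → ZMod 2) ℝ} (hA : IsReadoutNoise A)
    (w : B → ZMod 2) : |eigval A w| ≤ 1 := by
  rw [eigval_eq, abs_mul, abs_inv, abs_of_pos card_bits_pos]
  have hsum : |∑ a, ∑ b, (chi ((a + b) ⬝ᵥ w) : ℝ) * A a b| ≤ Fintype.card (B → ZMod 2) := by
    calc |∑ a, ∑ b, (chi ((a + b) ⬝ᵥ w) : ℝ) * A a b|
        ≤ ∑ a, |∑ b, (chi ((a + b) ⬝ᵥ w) : ℝ) * A a b| := abs_sum_le_sum_abs _ _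
      _ ≤ ∑ a, ∑ b, |(chi ((a + b) ⬝ᵥ w) : ℝ) * A a b| :=
          sum_le_sum fun a _ => abs_sum_le_sum_abs _ _
      _ = ∑ a, ∑ b, A a b := by
          refine sum_congr rfl fun a _ => sum_congr rfl fun b _ => ?_
          rw [abs_mul, abs_chi, one_mul, abs_of_nonneg (hA.nonneg a b)]
      _ = Fintype.card (B → ZMod 2) := by
          rw [sum_comm]
          simp_rw [hA.sum_eq_one]
          rw [sum_const, card_univ, nsmul_eq_mul, mul_one]
  calc (Fintype.card (B → ZMod 2) : ℝ)⁻¹ * |∑ a, ∑ b, (chi ((a + b) ⬝ᵥ w) : ℝ) * A a b|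
      ≤ (Fintype.card (B → ZMod 2) : ℝ)⁻¹ * Fintype.card (B → ZMod 2) := by
        gcongr
    _ = 1 := inv_mul_cancel₀ card_bits_pos.ne'

/-- `λ_w` is additive in the noise map (convex combinations, §4.3: `M = μM₁ + (1−μ)M₂`).
[cite: vandenBergMinevTemme2022, §4.3 p0007 L69–72] -/
theorem eigval_add (A A' : Matrix (B → ZMod 2) (B → ZMod 2) ℝ) (w : B → ZMod 2) :
    eigval (A + A') w = eigval A w + eigval A' w := by
  simp only [eigval_eq, Matrix.add_apply, mul_add, sum_add_distrib]

/-- `λ_w` is homogeneous in the noise map. [cite: vandenBergMinevTemme2022, §4.3 p0007 L69–72] -/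
theorem eigval_smul (μ : ℝ) (A : Matrix (B → ZMod 2) (B → ZMod 2) ℝ) (w : B → ZMod 2) :
    eigval (μ • A) w = μ * eigval A w := by
  simp only [eigval_eq, Matrix.smul_apply, smul_eq_mul]
  have h : ∀ a b : B → ZMod 2, (chi ((a + b) ⬝ᵥ w) : ℝ) * (μ * A a b)
      = μ * ((chi ((a + b) ⬝ᵥ w) : ℝ) * A a b) := fun a b => by ring
  simp_rw [h, ← mul_sum]
  ring

/-! ### Expectation values of `Z_w` through the (twirled) read-out noise -/

/-- `⟨Z_w⟩ = Σ_x (−1)^{⟨w,x⟩} p(x)` for an outcome law `p` (`p(x) = Tr(E_x ρ)`).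
[cite: vandenBergMinevTemme2022, §3 eq. (IdealZs) p0005 L17–21] -/
def zExp (p : (B → ZMod 2) → ℝ) (w : B → ZMod 2) : ℝ := ∑ x, (chi (x ⬝ᵥ w) : ℝ) * p x

/-- Unfolding `zExp`. [cite: vandenBergMinevTemme2022, §3 eq. (IdealZs) p0005 L17–21] -/
theorem zExp_eq (p : (B → ZMod 2) → ℝ) (w : B → ZMod 2) :
    zExp p w = ∑ x, (chi (x ⬝ᵥ w) : ℝ) * p x := rfl

/-- The outcome law seen through the noise map: `(A p)(x) = Σ_y A_{x,y} p(y)` (substituting `E_x`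
by `Ẽ_x = Σ_y A_{x,y}|y⟩⟨y|`). [cite: vandenBergMinevTemme2022, §3 p0005 L8–9, L23–24] -/
def readout (A : Matrix (B → ZMod 2) (B → ZMod 2) ℝ) (p : (B → ZMod 2) → ℝ) : (B → ZMod 2) → ℝ :=
  fun x => ∑ y, A x y * p y

/-- `readout A p` is the matrix–vector product `A *ᵥ p` ("The noisy readout probabilities are then
given by the vector `A [H_n^{−1}, 0] |ρ⟩⟩`"). [cite: vandenBergMinevTemme2022, §3.1 p0005 L110–114] -/
theorem readout_eq_mulVec (A : Matrix (B → ZMod 2) (B → ZMod 2) ℝ) (p : (B → ZMod 2) → ℝ) :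
    readout A p = A *ᵥ p := rfl

/-- **`⟨Z̃⋆_w⟩_ρ = λ_w ⟨Z_w⟩_ρ`**: through the twirled noise every Pauli-Z expectation value is
multiplied by the single factor `λ_w`, whatever the state.
[cite: vandenBergMinevTemme2022, §3 eq. (TwirledZs) and p0005 L82–94] -/
theorem zExp_readout_twirl (A : Matrix (B → ZMod 2) (B → ZMod 2) ℝ) (p : (B → ZMod 2) → ℝ)
    (w : B → ZMod 2) : zExp (readout (twirl A) p) w = eigval A w * zExp p w := by
  calc zExp (readout (twirl A) p) w
      = ∑ y, (∑ x, (chi (x ⬝ᵥ w) : ℝ) * twirl A x y) * p y := by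
        simp only [zExp_eq, readout, mul_sum, sum_mul]
        rw [sum_comm]
        refine sum_congr rfl fun y _ => sum_congr rfl fun x _ => ?_
        ring
    _ = eigval A w * zExp p w := by
        simp_rw [sum_chi_mul_twirl, zExp_eq, mul_sum, mul_assoc]

/-- On the initial state `|0…0⟩` (outcome law `δ_0`) every `⟨Z_w⟩` equals `1`.
[cite: vandenBergMinevTemme2022, §3 p0005 L97–98] -/
theorem zExp_single_zero (w : B → ZMod 2) : zExp (Pi.single (0 : B → ZMod 2) (1 : ℝ)) w = 1 := by
  rw [zExp_eq, sum_eq_single (0 : B → ZMod 2)]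
  · rw [Pi.single_eq_same, zero_dotProduct, chi_zero, mul_one]
  · intro x _ hx
    rw [Pi.single_eq_of_ne hx, mul_zero]
  · intro h
    exact absurd (mem_univ _) h

/-- **Calibration**: the twirled noisy expectation value measured on `|0…0⟩` IS `λ_w`
("`⟨Z̃⋆_w⟩_ρ = λ_w`. The protocol estimates this quantity").
[cite: vandenBergMinevTemme2022, §3 p0005 L97–101] -/
theorem zExp_readout_twirl_single_zero (A : Matrix (B → ZMod 2) (B → ZMod 2) ℝ)
    (w : B → ZMod 2) : zExp (readout (twirl A) (Pi.single 0 1)) w = eigval A w := by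
  rw [zExp_readout_twirl, zExp_single_zero, mul_one]

/-- **Protocol 1 in the infinite-sample limit** ("Return estimate `f(𝒟₁,s)/f(𝒟₀,s)`"): dividing the
twirled noisy expectation value by the calibration value recovers the ideal `⟨Z_w⟩_ρ` exactly,
for ANY read-out noise map, as soon as `λ_w ≠ 0`.
[cite: vandenBergMinevTemme2022, §2 Protocol 1 p0004 L70–76 and §3 p0005 L97–101] -/
theorem mitigated_eq (A : Matrix (B → ZMod 2) (B → ZMod 2) ℝ) (p : (B → ZMod 2) → ℝ)
    {w : B → ZMod 2} (hw : eigval A w ≠ 0) :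
    zExp (readout (twirl A) p) w / zExp (readout (twirl A) (Pi.single 0 1)) w = zExp p w := by
  rw [zExp_readout_twirl, zExp_readout_twirl_single_zero, mul_div_cancel_left₀ _ hw]

/-! ### The operator transfer matrix `M = H A H^{−1}` and its diagonalisation -/

/-- `M = H_n A H_n^{−1}`, the "readout transition matrix for operators", with the Walsh–Hadamard
matrix `(H_n)_{w,x} = (−1)^{⟨w,x⟩}` and `H_n^{−1} = 2^{−n} H_nᵀ`:
`M_{w,v} = 2^{−n} Σ_{x,y} (−1)^{⟨w,x⟩} A_{x,y} (−1)^{⟨v,y⟩}`.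
[cite: vandenBergMinevTemme2022, §3.1 p0005 L116–126 and §4.3 p0007 L65–67] -/
def transfer (A : Matrix (B → ZMod 2) (B → ZMod 2) ℝ) : Matrix (B → ZMod 2) (B → ZMod 2) ℝ :=
  of fun w v => (Fintype.card (B → ZMod 2) : ℝ)⁻¹ *
    ∑ x, ∑ y, (chi (x ⬝ᵥ w) : ℝ) * A x y * chi (y ⬝ᵥ v)

/-- Entry formula of `M`. [cite: vandenBergMinevTemme2022, §3.1 p0005 L122–126] -/
theorem transfer_apply (A : Matrix (B → ZMod 2) (B → ZMod 2) ℝ) (w v : B → ZMod 2) :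
    transfer A w v = (Fintype.card (B → ZMod 2) : ℝ)⁻¹ *
      ∑ x, ∑ y, (chi (x ⬝ᵥ w) : ℝ) * A x y * chi (y ⬝ᵥ v) := rfl

/-- `diag(M) = λ`: `M_{w,w} = λ_w`. [cite: vandenBergMinevTemme2022, §3.1 p0005 L148–151] -/
theorem transfer_apply_self (A : Matrix (B → ZMod 2) (B → ZMod 2) ℝ) (w : B → ZMod 2) :
    transfer A w w = eigval A w := by
  rw [transfer_apply, eigval_eq]
  congr 1
  refine sum_congr rfl fun x _ => sum_congr rfl fun y _ => ?_
  rw [add_dotProduct, chi_add]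
  ring

/-- **The twirl diagonalises the measurement channel**: `(H A⋆ H^{−1})_{w,v} = λ_w [w = v]`
("the expected observable vector is therefore given by `[M ⊙ I, 0]`").
[cite: vandenBergMinevTemme2022, §3.1 p0005 L127–146; abstract/§1 p0003 L77–80] -/
theorem transfer_twirl (A : Matrix (B → ZMod 2) (B → ZMod 2) ℝ) (w v : B → ZMod 2) :
    transfer (twirl A) w v = if w = v then eigval A w else 0 := by
  rw [transfer_apply]
  have h : ∑ x, ∑ y, (chi (x ⬝ᵥ w) : ℝ) * twirl A x y * chi (y ⬝ᵥ v)
      = eigval A w * ∑ y, (chi (y ⬝ᵥ w) : ℝ) * chi (y ⬝ᵥ v) := by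
    rw [sum_comm]
    simp_rw [← sum_mul, sum_chi_mul_twirl, mul_sum, mul_assoc]
  rw [h, sum_chi_mul_chi, ← card_bits]
  split_ifs
  · rw [mul_left_comm, inv_mul_cancel₀ card_bits_pos.ne', mul_one]
  · rw [mul_zero, mul_zero]

/-- Matrix form: `H A⋆ H^{−1} = diag(λ)`. [cite: vandenBergMinevTemme2022, §3.1 p0005 L138–146] -/
theorem transfer_twirl_eq_diagonal (A : Matrix (B → ZMod 2) (B → ZMod 2) ℝ) :
    transfer (twirl A) = diagonal (eigval A) := by
  ext w v
  rw [transfer_twirl, diagonal_apply]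

/-! ### Independent bit flips (§4.3) -/

/-- Independent symmetric bit flips: qubit `i` is misread with probability `r i`
(`A = ⊗_ℓ A_ℓ`, `A_ℓ = [1−r_ℓ, r_ℓ; r_ℓ, 1−r_ℓ]`, the case `r = s` of eq. (AiMatrix)).
[cite: vandenBergMinevTemme2022, §4.3 p0007 L74–85] -/
def indepFlip (r : B → ℝ) : Matrix (B → ZMod 2) (B → ZMod 2) ℝ :=
  of fun x y => ∏ i, if x i = y i then 1 - r i else r i

omit [DecidableEq B] in
/-- Entry formula of `indepFlip`. [cite: vandenBergMinevTemme2022, §4.3 p0007 L79–85] -/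
theorem indepFlip_apply (r : B → ℝ) (x y : B → ZMod 2) :
    indepFlip r x y = ∏ i, if x i = y i then 1 - r i else r i := rfl

omit [DecidableEq B] in
/-- Independent flips commute with every bit flip `X_s`.
[cite: vandenBergMinevTemme2022, §4.3 p0007 L97–100] -/
theorem indepFlip_add_add (r : B → ℝ) (x y s : B → ZMod 2) :
    indepFlip r (x + s) (y + s) = indepFlip r x y := by
  simp only [indepFlip_apply, Pi.add_apply, add_left_inj]

/-- Hence the twirl leaves `indepFlip r` unchanged ("since `M` is already diagonal, we do not need
to shrink the off-diagonal elements"). [cite: vandenBergMinevTemme2022, §4.3 p0007 L97–100] -/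
theorem twirl_indepFlip (r : B → ℝ) : twirl (indepFlip r) = indepFlip r :=
  twirl_eq_self_of_forall_add_add _ (indepFlip_add_add r)

/-- `indepFlip r` is a read-out noise map for flip probabilities in `[0, 1]`.
[cite: vandenBergMinevTemme2022, §4.3 p0007 L74–85] -/
theorem isReadoutNoise_indepFlip {r : B → ℝ} (h0 : ∀ i, 0 ≤ r i) (h1 : ∀ i, r i ≤ 1) :
    IsReadoutNoise (indepFlip r) := by
  refine ⟨fun x y => ?_, fun y => ?_⟩
  · rw [indepFlip_apply]
    exact prod_nonneg fun i _ => by split_ifs <;> linarith [h0 i, h1 i]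
  · simp_rw [indepFlip_apply]
    rw [← Fintype.prod_sum fun i (u : ZMod 2) => if u = y i then 1 - r i else r i]
    refine prod_eq_one fun i _ => ?_
    rw [sum_zmod_two]
    have hy : y i = 0 ∨ y i = 1 := by
      generalize y i = u
      revert u
      decide
    rcases hy with h | h <;> simp [h]

/-- **The diagonal of `M` for independent flips**: `λ_w = ∏_{i : w_i ≠ 0} (1 − 2 r_i)`
("`H A H^{−1} = ⊗_ℓ [1 0; 0 (1−2r_ℓ)]`", eq. (BitFlipM)).
[cite: vandenBergMinevTemme2022, §4.3 eq. (BitFlipM) p0007 L86–95] -/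
theorem eigval_indepFlip (r : B → ℝ) (w : B → ZMod 2) :
    eigval (indepFlip r) w = ∏ i, if w i = 0 then 1 else 1 - 2 * r i := by
  rw [eigval_eq_sum_chi_mul_twirl, twirl_indepFlip]
  have hterm : ∀ x : B → ZMod 2, (chi (x ⬝ᵥ w) : ℝ) * indepFlip r x 0
      = ∏ i, ((chi (x i * w i) : ℝ) * if x i = 0 then 1 - r i else r i) := by
    intro x
    rw [indepFlip_apply, dotProduct, chi_finset_sum, ← prod_mul_distrib]
    rfl
  simp_rw [hterm]
  rw [← Fintype.prod_sum fun i (u : ZMod 2) =>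
    (chi (u * w i) : ℝ) * if u = 0 then 1 - r i else r i]
  refine prod_congr rfl fun i _ => ?_
  rw [sum_zmod_two]
  have hw : w i = 0 ∨ w i = 1 := by
    generalize w i = u
    revert u
    decide
  rcases hw with h | h
  · simp [h]
  · simp only [h, mul_one, one_ne_zero, if_true, if_false, chi_zero, one_mul,
      chi_of_ne_zero (K := ℝ) one_ne_zero]
    ring

/-- Uniform flip probability: `λ_w = (1 − 2r)^k` with `k` the weight (number of non-identity
factors) of `Z_w`. [cite: vandenBergMinevTemme2022, §4.3 p0007 L101–106] -/
theorem eigval_indepFlip_const (r : ℝ) (w : B → ZMod 2) :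
    eigval (indepFlip fun _ : B => r) w = (1 - 2 * r) ^ (univ.filter fun i => w i ≠ 0).card := by
  rw [eigval_indepFlip, prod_ite, prod_const_one, one_mul, prod_const]

/-- "The term `(1−2r)^k` is bounded below by `1−2kr`" (Bernoulli; needs `r ≤ 1`).
[cite: vandenBergMinevTemme2022, §4.3 p0007 L106–107] -/
theorem one_sub_mul_le_one_sub_two_mul_pow {r : ℝ} (hr : r ≤ 1) (k : ℕ) :
    1 - 2 * k * r ≤ (1 - 2 * r) ^ k := by
  have h := one_add_mul_le_pow (show (-2 : ℝ) ≤ -(2 * r) by linarith) k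
  have e1 : (1 : ℝ) + (k : ℝ) * -(2 * r) = 1 - 2 * k * r := by ring
  have e2 : (1 : ℝ) + -(2 * r) = 1 - 2 * r := by ring
  rw [e1, e2] at h
  exact h

/-- The printed instance: "for 30 qubits with 1% probability of a measurement flip, the diagonal
elements in `M` are still at least 0.4". [cite: vandenBergMinevTemme2022, §4.3 p0007 L107–109] -/
theorem thirty_qubits_one_percent : (0.4 : ℝ) ≤ (1 - 2 * 0.01) ^ 30 :=
  le_trans (by norm_num) (one_sub_mul_le_one_sub_two_mul_pow (show (0.01 : ℝ) ≤ 1 by norm_num) 30)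

/-! ### §4.1: the ratio lemma and the arithmetic of the sample bound -/

/-- **Lemma 4.1.** "Let `x, y` be such that `0 ≤ |x| ≤ |y| ≤ 1`. Given estimates `x̂, ŷ` with
`|x − x̂| ≤ α` and `|y − ŷ| ≤ α`, such that `0 ≤ α ≤ |y|/2`. Then `|x̂/ŷ − x/y| ≤ 4α/y`." Here with
`|y|` in the bound (the source argues under "without loss of generality `x, y ≥ 0`"); the printed
hypothesis `|y| ≤ 1` is not needed. [cite: vandenBergMinevTemme2022, §4.1 Lemma 4.1 p0006 L14–42] -/
theorem abs_div_sub_div_le {x y x' y' α : ℝ} (hxy : |x| ≤ |y|) (hx : |x - x'| ≤ α)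
    (hy : |y - y'| ≤ α) (hα : 0 ≤ α) (hα2 : α ≤ |y| / 2) :
    |x' / y' - x / y| ≤ 4 * α / |y| := by
  rcases eq_or_ne y 0 with rfl | hy0
  · have hα0 : α = 0 := le_antisymm (by simpa using hα2) hα
    have hx0 : x = 0 := by simpa using hxy
    have hx'0 : x' = 0 := by
      rw [hx0, hα0, zero_sub, abs_neg, abs_nonpos_iff] at hx
      exact hx
    simp [hx'0]
  · have hypos : 0 < |y| := abs_pos.mpr hy0
    have hy'ge : |y| / 2 ≤ |y'| := by
      have := abs_sub_abs_le_abs_sub y y'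
      linarith
    have hy'pos : 0 < |y'| := lt_of_lt_of_le (by linarith) hy'ge
    have hy'0 : y' ≠ 0 := abs_pos.mp hy'pos
    rw [div_sub_div _ _ hy'0 hy0, abs_div, abs_mul, div_le_div_iff₀ (mul_pos hy'pos hypos) hypos]
    have hnum : |x' * y - y' * x| ≤ 2 * α * |y| := by
      have hrw : x' * y - y' * x = (x' - x) * y + x * (y - y') := by ring
      rw [hrw]
      calc |(x' - x) * y + x * (y - y')|
          ≤ |(x' - x) * y| + |x * (y - y')| := abs_add_le _ _
        _ = |x' - x| * |y| + |x| * |y - y'| := by rw [abs_mul, abs_mul]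
        _ ≤ α * |y| + |y| * α := by
            gcongr
            rwa [abs_sub_comm]
        _ = 2 * α * |y| := by ring
    calc |x' * y - y' * x| * |y| ≤ 2 * α * |y| * |y| := by gcongr
      _ = 4 * α * (|y| / 2 * |y|) := by ring
      _ ≤ 4 * α * (|y'| * |y|) := by gcongr

/-- Hoeffding's tail `Pr(|X̄ − 𝔼X| ≥ α) ≤ 2 exp(−Nα²/2)` pushed below `δ/2` is the printed
condition `N ≥ 2 log(4/δ)/α²` (eqs. (HoeffdingA), (IntermediateNValue)); the probabilistic
inequality itself is not formalised here.
[cite: vandenBergMinevTemme2022, §4.1 proof of Theorem 4.2 p0006 L61–81] -/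
theorem two_mul_exp_le_iff {N α δ : ℝ} (hα : 0 < α) (hδ : 0 < δ) :
    2 * Real.exp (-(N * α ^ 2) / 2) ≤ δ / 2 ↔ 2 * Real.log (4 / δ) / α ^ 2 ≤ N := by
  have hα2 : 0 < α ^ 2 := by positivity
  rw [div_le_iff₀ hα2, Real.log_div (by norm_num) hδ.ne']
  constructor
  · intro h
    have h1 : Real.exp (-(N * α ^ 2) / 2) ≤ δ / 4 := by linarith
    have h2 := (Real.le_log_iff_exp_le (by positivity)).mpr h1
    rw [Real.log_div hδ.ne' (by norm_num)] at h2
    linarith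
  · intro h
    have h1 : -(N * α ^ 2) / 2 ≤ Real.log (δ / 4) := by
      rw [Real.log_div hδ.ne' (by norm_num)]
      linarith
    have h2 := (Real.le_log_iff_exp_le (by positivity)).mp h1
    linarith

/-- With `α = ε M_{i,i}/4` (so that Lemma 4.1's `4α/M_{i,i} = ε`) the condition
`N ≥ 2 log(4/δ)/α²` is Theorem 4.2's "`N ≥ 32 log(4/δ)/(M_{i,i}² ε²)`".
[cite: vandenBergMinevTemme2022, §4.1 Theorem 4.2 p0006 L46–53 and L83–87] -/
theorem sampleBound_eq (δ ε M : ℝ) :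
    2 * Real.log (4 / δ) / (ε * M / 4) ^ 2 = 32 * Real.log (4 / δ) / (M ^ 2 * ε ^ 2) := by
  rcases eq_or_ne M 0 with rfl | hM
  · simp
  rcases eq_or_ne ε 0 with rfl | hε
  · simp
  field_simp
  ring

/-- Lemma 4.1's bound evaluated at `α = ε M/4`: `4α/M = ε`.
[cite: vandenBergMinevTemme2022, §4.1 proof of Theorem 4.2 p0006 L83–87] -/
theorem four_mul_div_eq {ε M : ℝ} (hM : M ≠ 0) : 4 * (ε * M / 4) / M = ε := by
  field_simp

end TREX

end Literature.InformationTheory.QuantumLearning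

end
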